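import Summits.KontsevichZagierPeriods.KontsevichZagierPeriods.Theorems.UnfoldedStokesStokesGenerationStubSubdivisionVar
import Summits.KontsevichZagierPeriods.KontsevichZagierPeriods.Theorems.UnfoldedStokesStokesGenerationFibrewiseRungAngSwap
import Summits.KontsevichZagierPeriods.KontsevichZagierPeriods.Theorems.UnfoldedStokesStokesGenerationFibrewiseClosureCongr
import Literature.NumberTheory.Transcendental.SemialgebraicMapsProofs
import Mathlib.Analysis.SpecialFunctions.Sqrt

/-!
# `StokesGeneration` (stmt-KontsevichZagierPeriods-3586) — line `fibrewise_stokes`, stub `stub_anchorCut` (RUNG A, A1)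

Registered stub A1 (wave 8, lead c6) of the line `fibrewise_stokes` of the crux `StokesGeneration` (route
UnfoldedStokes), the first step of RUNG A (the anchor `π²`): **cutting the square along the curve
`w = φ(y)`** for the bounded smooth integrand `k₁(w, y) = 4/((1 + yw)(1 + y − y(1−y)w))` (value `π²/4`, the corner
blow-up of `4/(1 − X²Y²)` on the sector `{X ≥ Y}`), with the height
`φ(y) = (1 + y)/(√(2 − y²)(1 + √(2 − y²))) ∈ [1 − 1/√2, 1]` (the preimage `Γ⁻¹{ξ = 1}` of the diagonal line of
Calabi's triangle). The relator `k₁ − φ·k₁(φw, y) − (1 − φ)·k₁(φ + (1 − φ)w, y)` — Kontsevich–Zagier's rule (1) along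
the semialgebraic graph `w = φ(y)` followed by rule (2) for the two rescalings back to the square — is fibrewise-Stokes
decomposable (`FibStokesDecomposable 2`, `Theorems/UnfoldedStokesDefs.lean`).

Proof. This is the landed variable-height subdivision theorem `stub_subdivisionVar` (rung 21) on `[0,1]³` with cut
coordinate `a = 0` (`w`), idle coordinate `b = 2`, `f(x) = k₁(x 0, x 1)` and `φ(x) = φ(x 1)`, then un-padded to the
square (`fibStokesDecomposable_unpad`, `fibStokesDecomposable_congr_off_null` with the empty null set). The
hypotheses are elementary: `φ` is `ℚ`-semialgebraic (square root of the polynomial `2 − y² ≥ 1`, quotient with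
non-vanishing denominator) and continuous with values in `[0,1]` (`φ ≤ 1 ⟺ 1 + y ≤ √(2 − y²) + 2 − y²`, and
`√(2 − y²) ≥ 1 ≥ y + y² − 1`); `k₁` is a quotient of polynomials whose denominator is `≥ 1` on the square
(`1 + y − y(1−y)w ≥ 1 + y²`), hence `ℚ`-semialgebraic, continuous and `C¹` along `w` with the explicit rational fibre
derivative `∂k₁/∂w = −4[y(1 + y − y(1−y)w) − y(1−y)(1 + yw)]/((1 + yw)(1 + y − y(1−y)w))²`. The final pointwise
identity is syntactic. Transcendence-free, value-free.

References: M. Kontsevich, D. Zagier, *Periods* (2001), §1.1 (the `ζ(2)` example), §1.2 rules (1), (2);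
J. Ayoub, Ann. of Math. 181 (2015), Rem. 1.5; J. Bochnak, M. Coste, M.-F. Roy, *Real Algebraic Geometry* (1998),
Prop. 2.2.6.
-/

noncomputable section

-- `Summit.KontsevichZagierPeriods.KontsevichZagierPeriods.…` is the tree's mandated layout (single-conjunct summit).
set_option linter.dupNamespace false

namespace Summit.KontsevichZagierPeriods.KontsevichZagierPeriods.Cruxes.StokesGeneration.FibrewiseStokes

open MeasureTheory Set
open Literature.NumberTheory.Transcendental
open Literature.NumberTheory.Transcendental.KZ
open Literature.ModelTheory.ExponentialFields (IsSemialgebraic)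

/-- On `[0,1]`, `1 ≤ √(2 − y²)`. [folklore] -/
private theorem anchorCut_one_le_sqrt {y : ℝ} (hy : y ∈ Set.Icc (0:ℝ) 1) : 1 ≤ Real.sqrt (2 - y ^ 2) := by
  rw [Real.one_le_sqrt]
  nlinarith [hy.1, hy.2]

/-- The cutting height `φ(y) = (1 + y)/(√(2 − y²)(1 + √(2 − y²)))` lies in `[0,1]` for `y ∈ [0,1]`:
`φ ≤ 1 ⟺ 1 + y ≤ √(2 − y²) + 2 − y²`, and `√(2 − y²) ≥ 1 ≥ y + y² − 1`. [folklore] -/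
private theorem anchorCut_height_mem {y : ℝ} (hy : y ∈ Set.Icc (0:ℝ) 1) :
    (1 + y) / (Real.sqrt (2 - y ^ 2) * (1 + Real.sqrt (2 - y ^ 2))) ∈ Set.Icc (0:ℝ) 1 := by
  have hS := anchorCut_one_le_sqrt hy
  have hS2 : Real.sqrt (2 - y ^ 2) ^ 2 = 2 - y ^ 2 := Real.sq_sqrt (by nlinarith [hy.1, hy.2])
  have hpos : 0 < Real.sqrt (2 - y ^ 2) * (1 + Real.sqrt (2 - y ^ 2)) :=
    mul_pos (by linarith) (by linarith)
  refine ⟨div_nonneg (by linarith [hy.1]) hpos.le, (div_le_one hpos).2 ?_⟩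
  nlinarith [hS, hS2, hy.1, hy.2, mul_nonneg hy.1 (sub_nonneg.2 hy.2)]

/-- The denominator `(1 + yw)(1 + y − y(1−y)w)` of `k₁` is positive on the square (both factors are `≥ 1`:
`1 + y − y(1−y)w ≥ 1 + y − y(1−y) = 1 + y²`). [folklore] -/
private theorem anchorCut_den_pos {w y : ℝ} (hw : w ∈ Set.Icc (0:ℝ) 1) (hy : y ∈ Set.Icc (0:ℝ) 1) :
    0 < (1 + y * w) * (1 + y - y * (1 - y) * w) := by
  have h1 : 1 ≤ 1 + y * w := by nlinarith [mul_nonneg hy.1 hw.1]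
  have h0 : 0 ≤ y * (1 - y) := mul_nonneg hy.1 (by linarith [hy.2])
  have h2 : y * (1 - y) * w ≤ y * (1 - y) := by nlinarith [hw.2]
  have h3 : 1 ≤ 1 + y - y * (1 - y) * w := by nlinarith [sq_nonneg y]
  exact mul_pos (by linarith) (by linarith)

/-- The fibre derivative of `k₁(w, y) = 4/((1 + yw)(1 + y − y(1−y)w))` along `w` (quotient rule). [folklore] -/
private theorem anchorCut_hasDerivAt {w y : ℝ} (hD : (1 + y * w) * (1 + y - y * (1 - y) * w) ≠ 0) :
    HasDerivAt (fun s : ℝ => 4 / ((1 + y * s) * (1 + y - y * (1 - y) * s)))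
      (-(4 * (y * (1 + y - y * (1 - y) * w) - (1 + y * w) * (y * (1 - y)))) /
        ((1 + y * w) * (1 + y - y * (1 - y) * w)) ^ 2) w := by
  have hx := hasDerivAt_id' w
  have h1 : HasDerivAt (fun s : ℝ => 1 + y * s) y w := by
    simpa using (hx.const_mul y).const_add 1
  have h2 : HasDerivAt (fun s : ℝ => 1 + y - y * (1 - y) * s) (-(y * (1 - y))) w := by
    simpa using (hx.const_mul (y * (1 - y))).const_sub (1 + y)
  exact ((hasDerivAt_const w (4:ℝ)).fun_div (h1.fun_mul h2) hD).congr_deriv (by ring)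

/-- **Registered stub `stub_anchorCut` (RUNG A, A1): cutting the square along `w = φ(y)` for the anchor integrand
`k₁(w, y) = 4/((1 + yw)(1 + y − y(1−y)w))`, `φ(y) = (1 + y)/(√(2 − y²)(1 + √(2 − y²)))`.** The relator
`k₁ − φ·k₁(φw, y) − (1 − φ)·k₁(φ + (1 − φ)w, y)` (rule (1) along the semialgebraic graph `w = φ(y)`, then rule (2)
for the two rescalings) is fibrewise-Stokes decomposable on `[0,1]²`: the variable-height subdivision theorem
(`stub_subdivisionVar`) on `[0,1]³` with an idle third coordinate, un-padded to the square. Transcendence-free,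
value-free. [cite: KontsevichZagier2001, §1.2 rules (1), (2)] -/
theorem stub_anchorCut :
    FibStokesDecomposable 2 (fun z =>
      4 / ((1 + z 1 * z 0) * (1 + z 1 - z 1 * (1 - z 1) * z 0)) -
      (1 + z 1) / (Real.sqrt (2 - z 1 ^ 2) * (1 + Real.sqrt (2 - z 1 ^ 2))) *
        (4 / ((1 + z 1 * ((1 + z 1) / (Real.sqrt (2 - z 1 ^ 2) * (1 + Real.sqrt (2 - z 1 ^ 2))) * z 0)) *
          (1 + z 1 - z 1 * (1 - z 1) * ((1 + z 1) / (Real.sqrt (2 - z 1 ^ 2) * (1 + Real.sqrt (2 - z 1 ^ 2))) * z 0)))) -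
      (1 - (1 + z 1) / (Real.sqrt (2 - z 1 ^ 2) * (1 + Real.sqrt (2 - z 1 ^ 2)))) *
        (4 / ((1 + z 1 * ((1 + z 1) / (Real.sqrt (2 - z 1 ^ 2) * (1 + Real.sqrt (2 - z 1 ^ 2))) +
            (1 - (1 + z 1) / (Real.sqrt (2 - z 1 ^ 2) * (1 + Real.sqrt (2 - z 1 ^ 2)))) * z 0)) *
          (1 + z 1 - z 1 * (1 - z 1) * ((1 + z 1) / (Real.sqrt (2 - z 1 ^ 2) * (1 + Real.sqrt (2 - z 1 ^ 2))) +
            (1 - (1 + z 1) / (Real.sqrt (2 - z 1 ^ 2) * (1 + Real.sqrt (2 - z 1 ^ 2)))) * z 0))))) := by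
  classical
  set C : Set (Fin 3 → ℝ) := Set.pi Set.univ (fun _ : Fin 3 => Set.Icc (0:ℝ) 1) with hC
  have hCsa : IsSemialgebraic ℚ C := by rw [hC, ← cube_eq_pi]; exact isSemialgebraic_cube
  have hmem : ∀ x ∈ C, ∀ i, x i ∈ Set.Icc (0:ℝ) 1 := fun x hx i => (Set.mem_univ_pi.mp hx) i
  have h10 : (1 : Fin 3) ≠ 0 := by decide
  have h12 : (1 : Fin 3) ≠ 2 := by decide
  have h02 : (0 : Fin 3) ≠ 2 := by decide
  -- the data on `[0,1]³`: coordinates `w = x 0`, `y = x 1`, idle `x 2`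
  obtain ⟨φ, hφ⟩ : ∃ φ : (Fin 3 → ℝ) → ℝ, φ = fun x =>
      (1 + x 1) / (Real.sqrt (2 - x 1 ^ 2) * (1 + Real.sqrt (2 - x 1 ^ 2))) := ⟨_, rfl⟩
  obtain ⟨f, hf⟩ : ∃ f : (Fin 3 → ℝ) → ℝ, f = fun x =>
      4 / ((1 + x 1 * x 0) * (1 + x 1 - x 1 * (1 - x 1) * x 0)) := ⟨_, rfl⟩
  obtain ⟨fₐ, hfₐ⟩ : ∃ fₐ : (Fin 3 → ℝ) → ℝ, fₐ = fun x =>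
      -(4 * (x 1 * (1 + x 1 - x 1 * (1 - x 1) * x 0) - (1 + x 1 * x 0) * (x 1 * (1 - x 1)))) /
        ((1 + x 1 * x 0) * (1 + x 1 - x 1 * (1 - x 1) * x 0)) ^ 2 := ⟨_, rfl⟩
  -- positivity of the denominators on the cube
  have hSge : ∀ x ∈ C, 1 ≤ Real.sqrt (2 - x 1 ^ 2) := fun x hx => anchorCut_one_le_sqrt (hmem x hx 1)
  have hφden : ∀ x ∈ C, Real.sqrt (2 - x 1 ^ 2) * (1 + Real.sqrt (2 - x 1 ^ 2)) ≠ 0 := fun x hx =>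
    (mul_pos (by linarith [hSge x hx]) (by linarith [hSge x hx])).ne'
  have hDne : ∀ x ∈ C, (1 + x 1 * x 0) * (1 + x 1 - x 1 * (1 - x 1) * x 0) ≠ 0 := fun x hx =>
    (anchorCut_den_pos (hmem x hx 0) (hmem x hx 1)).ne'
  have hDne2 : ∀ x ∈ C, ((1 + x 1 * x 0) * (1 + x 1 - x 1 * (1 - x 1) * x 0)) ^ 2 ≠ 0 := fun x hx =>
    pow_ne_zero 2 (hDne x hx)
  -- semialgebraicity
  have hx0 : IsSemialgebraicFunOn ℚ C (fun x => x 0) := isSemialgebraicFunOn_apply hCsa 0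
  have hx1 : IsSemialgebraicFunOn ℚ C (fun x => x 1) := isSemialgebraicFunOn_apply hCsa 1
  have h1sa : IsSemialgebraicFunOn ℚ C (fun _ => (1:ℝ)) :=
    isSemialgebraicFunOn_const_of_isAlgebraic hCsa isAlgebraic_one
  have h2sa : IsSemialgebraicFunOn ℚ C (fun _ => (2:ℝ)) := isSemialgebraicFunOn_const_ofNat hCsa 2
  have h4sa : IsSemialgebraicFunOn ℚ C (fun _ => (4:ℝ)) := isSemialgebraicFunOn_const_ofNat hCsa 4
  have hSsa : IsSemialgebraicFunOn ℚ C (fun x => Real.sqrt (2 - x 1 ^ 2)) :=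
    (h2sa.fun_sub (hx1.fun_pow 2)).fun_sqrt
  have hφsa : IsSemialgebraicFunOn ℚ C φ := by
    rw [hφ]; exact (h1sa.fun_add hx1).div (hSsa.fun_mul (h1sa.fun_add hSsa)) hφden
  have hD1sa : IsSemialgebraicFunOn ℚ C (fun x => 1 + x 1 * x 0) := h1sa.fun_add (hx1.fun_mul hx0)
  have hD2sa : IsSemialgebraicFunOn ℚ C (fun x => 1 + x 1 - x 1 * (1 - x 1) * x 0) :=
    (h1sa.fun_add hx1).fun_sub ((hx1.fun_mul (h1sa.fun_sub hx1)).fun_mul hx0)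
  have hDsa := hD1sa.fun_mul hD2sa
  have hfsa : IsSemialgebraicFunOn ℚ C f := by rw [hf]; exact h4sa.div hDsa hDne
  have hfₐsa : IsSemialgebraicFunOn ℚ C fₐ := by
    rw [hfₐ]
    exact (h4sa.fun_mul ((hx1.fun_mul hD2sa).fun_sub (hD1sa.fun_mul (hx1.fun_mul (h1sa.fun_sub hx1))))).fun_neg.div
      (hDsa.fun_pow 2) hDne2
  -- continuity on the cube
  have hSc : Continuous fun x : Fin 3 → ℝ => Real.sqrt (2 - x 1 ^ 2) := by fun_prop
  have hφc : ContinuousOn φ C := by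
    rw [hφ]
    exact (by fun_prop : Continuous fun x : Fin 3 → ℝ => 1 + x 1).continuousOn.div
      (hSc.mul (continuous_const.add hSc)).continuousOn hφden
  have hDc : Continuous fun x : Fin 3 → ℝ => (1 + x 1 * x 0) * (1 + x 1 - x 1 * (1 - x 1) * x 0) := by
    fun_prop
  have hfc : ContinuousOn f C := by rw [hf]; exact continuousOn_const.div hDc.continuousOn hDne
  have hfₐc : ContinuousOn fₐ C := by
    rw [hfₐ]
    exact (by fun_prop : Continuous fun x : Fin 3 → ℝ =>
      -(4 * (x 1 * (1 + x 1 - x 1 * (1 - x 1) * x 0) - (1 + x 1 * x 0) * (x 1 * (1 - x 1))))).continuousOn.div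
      (hDc.pow 2).continuousOn hDne2
  -- the height: idle coordinates, values in `[0,1]`
  have hφa : ∀ x s, φ (Function.update x 0 s) = φ x := fun x s => by
    simp only [hφ, Function.update_of_ne h10]
  have hφb : ∀ x s, φ (Function.update x 2 s) = φ x := fun x s => by
    simp only [hφ, Function.update_of_ne h12]
  have hφI : ∀ x ∈ C, φ x ∈ Set.Icc (0:ℝ) 1 := fun x hx => by
    rw [hφ]; exact anchorCut_height_mem (hmem x hx 1)
  -- the integrand: idle coordinate, fibre derivative along `w = x 0`
  have hfb : ∀ x s, f (Function.update x 2 s) = f x := fun x s => by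
    simp only [hf, Function.update_of_ne h12, Function.update_of_ne h02]
  have hfd : ∀ x ∈ C, x 0 ∈ Set.Ioo (0:ℝ) 1 →
      HasDerivAt (fun s => f (Function.update x 0 s)) (fₐ x) (x 0) := by
    intro x hx _
    have hfun : (fun s => f (Function.update x 0 s)) =
        fun s => 4 / ((1 + x 1 * s) * (1 + x 1 - x 1 * (1 - x 1) * s)) := by
      funext s; simp only [hf, Function.update_self, Function.update_of_ne h10]
    rw [hfun, hfₐ]
    exact anchorCut_hasDerivAt (hDne x hx)
  -- rung 21 on `[0,1]³`, then un-pad to the square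
  have hsub := stub_subdivisionVar (N := 3) 0 2 h02 φ f fₐ hφsa hφc hφa hφb hφI hfsa hfₐsa hfc hfₐc hfb hfd
  have h23 : (2:ℕ) ≤ 3 := by norm_num
  refine fibStokesDecomposable_unpad h23 _ (fibStokesDecomposable_congr_off_null 3 _ _ ∅
    Literature.ModelTheory.ExponentialFields.isSemialgebraic_empty measure_empty (fun x _ _ => ?_) hsub)
  have hc0 : x (Fin.castLE h23 0) = x 0 := rfl
  have hc1 : x (Fin.castLE h23 1) = x 1 := rfl
  simp only [hc0, hc1, hf, hφ, Function.update_self, Function.update_of_ne h10]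

end Summit.KontsevichZagierPeriods.KontsevichZagierPeriods.Cruxes.StokesGeneration.FibrewiseStokes

end
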